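import Summits.NavierStokesRegularity.NavierStokesRegularity.Theses.CalmSliceGate
import Summits.NavierStokesRegularity.NavierStokesRegularity.Theorems.LerayQuarterDissipationFiniteDissipationLiouvilleCalmSliceLeaf
import HarnessLib

/-!
# Route `CalmSliceGate`, crux `OneCalmSlice` (stmt-NavierStokesRegularity-24375): CLOSED

Theorems file of route `CalmSliceGate` (seat ns-lqd-p2 g4, cell ns-idea-3). The crux K1
`OneCalmSlice` — for all `C, K` there are `δ > 0`, `R > 0` such that a finite-dissipation Type-I
ancient mild profile with ONE `(δ, R)`-calm slice is bounded on a backward parabolic cylinder at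
the origin — is, verbatim, the calm-slice leaf `FiniteDissipationLiouville.CalmSlice.calmSlice_leaf`
of route `LerayQuarterDissipation` (Theorems/LerayQuarterDissipationFiniteDissipationLiouvilleCalmSlice{Forward,Scaling,Weak,Leaf}.lean:
forward uniqueness from a zero slice; scale invariance of the unsteadiness; the derivative-free
weak unsteadiness functional, de Rham, Leray's profile system and Tsai's `L⁶` Liouville theorem;
KNSS compactness across members with persistence of the singularity and dominated convergence).
Navier–Stokes regularity is NOT proved by this: the route's deciding crux `PerpetualFlickerLiouville`
and the shared residual `EnstrophyQuarterLaw` remain open; no summit is proved.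
-/

noncomputable section

-- the summit and its single sub-problem share the name (CONVENTIONS §1), as in every Theorems file
set_option linter.dupNamespace false

namespace Summit.NavierStokesRegularity.NavierStokesRegularity.Theorems

/-- **`OneCalmSlice` holds** (item stmt-NavierStokesRegularity-24375 of route `CalmSliceGate`):
the calm-slice leaf `FiniteDissipationLiouville.CalmSlice.calmSlice_leaf`, whose statement is the
body of the route decl verbatim. [cite: Tsai1998, Theorem 1 (p. 31)] -/
theorem oneCalmSlice_proof :
    Summit.NavierStokesRegularity.NavierStokesRegularity.Theses.CalmSliceGate.OneCalmSlice := by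
  unfold Summit.NavierStokesRegularity.NavierStokesRegularity.Theses.CalmSliceGate.OneCalmSlice
  exact FiniteDissipationLiouville.CalmSlice.calmSlice_leaf

end Summit.NavierStokesRegularity.NavierStokesRegularity.Theorems

end
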